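import Mathlib
import Summits.KontsevichZagierPeriods.Zeta5Search.DenomLaw.PathAccountingShallow
import HarnessLib

/-!
# ζ(5) search — DENOM-LAW D1: path weights on the STAR ZONE (at most the smallest parameter's block is long) — the `C⋆` lemmas

Cell `pub-zeta5`, track «DENOM-LAW» D1, seat `denom-prover-d1` gen 20 (`HOME/denom-law/prover-d1/ATTEMPT-20.md` §3), part 1 of 2
(part 2 = `DenomLaw/StarZonePath.lean`, the PATH node on the zone).  HONEST FRAMING: systematic search; MODEL/structure side —
elementary counting on Hamiltonian paths of `K₇` (no p-adics); nothing about ζ(5); no γ; no irrationality claim; records in print UNMOVED.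

THE STAR ZONE: `b` sorted (`Sorted7`: `b₁ ≥ … ≥ b₇`) with `b₀ − 2b₆ < p` — every parameter block `[b_k, b₀ − b_k]` except possibly the
smallest parameter's is shorter than `p` (fam-rv's «at most one long block», slot `i = 6`).  Then every pair block reaching `p` is a STAR
EDGE `(k,7)` (`star_edge`), `d < 3p` (`dOf_lt_three_p`), and for the path weight of `DenomLaw.PathAccountingFirstPeriod`
(`pathWeight` = heavy interior vertices + heavy path edges; `C⋆ = cStar` its maximum), with `u` the position of vertex `7` on the path:
* `pathWeight_le_six_of_light` (`b₇ < p`: heavy slots avoid `u`, heavy edges sit at `u`; counting lemma `countA`) and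
  `pathWeight_le_six_of_short57` (`b₀ − b₅ − b₇ < p`: the only possible heavy edge is `{6,7}`, at most once on a path; `countB`): `C⋆ ≤ 6`
  off the sliver {`b₇ ≥ p`, `b₀ − b₅ − b₇ ≥ p`} (`cStar_le_six`);
* `pathWeight_le_five_of_noHeavyStar` (`b₇ < p` and no parameter `≥ p` is a long star partner): `C⋆ ≤ 5` — the far end of a heavy edge
  is a light vertex, so heavy slots avoid `u` and those far ends (`countC`);
* hence `C⋆ ≥ 6` exhibits a HEAVY STAR PARTNER and `b₂ ≥ p` (`witness_of_cStar_six`), and `C⋆ ≥ 3` gives `b₁ ≥ p` (`heavy_of_cStar_three`):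
  the witnesses of fam-rv's bonus `[LP]` and of `nbig ≥ 1, 2` consumed by part 2.
Every lemma was checked on the 114,713 exact first-period instances of g18's kit j267899 before typing (prover-d1 g20 `code/zonecheck.py`, 0 failures).
-/

namespace Summit.KontsevichZagierPeriods.Zeta5Search.DenomLaw.StarZone

open Finset
open Summit.KontsevichZagierPeriods.Zeta5Search.CasoratianValuation (InPolytope)
open Summit.KontsevichZagierPeriods.Zeta5Search.WedgeDictionary (dOf)
open Summit.KontsevichZagierPeriods.Zeta5Search.DenomLaw (Sorted7 pathWeight cStar)
open Summit.KontsevichZagierPeriods.Zeta5Search.DenomLaw.FirstPeriodKit (sorted7_chain)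

variable {b : ℕ → ℤ} {p : ℕ}

/-! ### §1 The star zone -/

/-- On a sorted vector every parameter `b₁,…,b₆` is at least `b₆`. -/
theorem ge_six (hs : Sorted7 b) : ∀ i : ℕ, i < 6 → b 6 ≤ b (i + 1) := by
  obtain ⟨s2, s3, s4, s5, s6, s7⟩ := sorted7_chain hs
  intro i hi
  interval_cases i <;> simp only [Nat.reduceAdd] <;> linarith

/-- On a sorted vector every parameter `b₂,…,b₇` is at most `b₂` … -/
theorem le_two (hs : Sorted7 b) : ∀ i : ℕ, 1 ≤ i → i < 7 → b (i + 1) ≤ b 2 := by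
  obtain ⟨s2, s3, s4, s5, s6, s7⟩ := sorted7_chain hs
  intro i hi1 hi7
  interval_cases i <;> simp only [Nat.reduceAdd] <;> linarith

/-- … and every parameter is at most `b₁`. -/
theorem le_one (hs : Sorted7 b) : ∀ i : ℕ, i < 7 → b (i + 1) ≤ b 1 := by
  obtain ⟨s2, s3, s4, s5, s6, s7⟩ := sorted7_chain hs
  intro i hi7
  interval_cases i <;> simp only [Nat.reduceAdd] <;> linarith

/-- **Star zone ⇒ short blocks**: every parameter block but the seventh is shorter than `p` (fam-rv's hypothesis, slot `i = 6`). -/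
theorem short_blocks (hs : Sorted7 b) (hz : b 0 - 2 * b 6 < p) : ∀ k ∈ (range 7).erase 6, b 0 - 2 * b (k + 1) < p := by
  intro k hk
  have hk' : k < 7 ∧ k ≠ 6 := by simpa [mem_erase, mem_range, and_comm] using hk
  have := ge_six hs k (by omega)
  linarith

/-- **Star zone ⇒ every long pair block is a star edge**: if `b₀ − b_{i+1} − b_{k+1} ≥ p` then one of `i, k` is `6` (0-based; the
smallest parameter `b₇`). -/
theorem star_edge (hs : Sorted7 b) (hz : b 0 - 2 * b 6 < p) {i k : ℕ} (hi : i < 7) (hk : k < 7)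
    (h : (p : ℤ) ≤ b 0 - b (i + 1) - b (k + 1)) : i = 6 ∨ k = 6 := by
  by_contra hne
  push Not at hne
  have h1 := ge_six hs i (by omega)
  have h2 := ge_six hs k (by omega)
  linarith

/-- A long star edge through the parameter of index `m ≠ 6` with `b₀ − b₅ − b₇ < p` forces `m = 5` (the edge `{6,7}`). -/
theorem star_partner_five (hs : Sorted7 b) (h57 : b 0 - b 5 - b 7 < p) {m : ℕ} (hm : m < 7) (hm6 : m ≠ 6)
    (h : (p : ℤ) ≤ b 0 - b (m + 1) - b 7) : m = 5 := by
  obtain ⟨s2, s3, s4, s5, s6, s7⟩ := sorted7_chain hs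
  by_contra hm5
  have hm4 : m < 5 := by omega
  have : b 5 ≤ b (m + 1) := by interval_cases m <;> simp only [Nat.reduceAdd] <;> linarith
  linarith

/-- **`d < 3p` on the star zone** (so `⌊d/p⌋ ≤ 2`). -/
theorem dOf_lt_three_p (hb : InPolytope b) (hs : Sorted7 b) (hz : b 0 - 2 * b 6 < p) : dOf b < 3 * (p : ℤ) := by
  obtain ⟨s2, s3, s4, s5, s6, s7⟩ := sorted7_chain hs
  have h7 : 0 ≤ b 7 := (hb.1.2 6 (by simp)).1
  unfold dOf
  simp only [sum_range_succ, sum_range_zero, zero_add, Nat.reduceAdd]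
  linarith

/-! ### §2 Counting lemmas on positions (decided) -/

/-- Interior slots off the position `u` plus the two path edges at `u` number at most `6`. -/
theorem countA (u : Fin 7) :
    ((univ : Finset (Fin 5)).filter fun s => s.val + 1 ≠ u.val).card +
      ((univ : Finset (Fin 6)).filter fun t => t.val = u.val ∨ t.val + 1 = u.val).card ≤ 6 := by
  revert u; decide

/-- The path edges at `u` number at most `2`. -/
theorem countA' (u : Fin 7) : ((univ : Finset (Fin 6)).filter fun t => t.val = u.val ∨ t.val + 1 = u.val).card ≤ 2 := by
  revert u; decide

/-- At most one path edge joins the positions `u` and `v`. -/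
theorem countB (u v : Fin 7) :
    ((univ : Finset (Fin 6)).filter fun t => (t.val = u.val ∧ t.val + 1 = v.val) ∨ (t.val = v.val ∧ t.val + 1 = u.val)).card ≤ 1 := by
  revert u v; decide

/-- Interior slots off `u` and off the far ends of the heavy edges at `u`, plus those edges, number at most `5`. -/
theorem countC (u : Fin 7) (e₁ e₂ : Bool) :
    ((univ : Finset (Fin 5)).filter fun s =>
        s.val + 1 ≠ u.val ∧ (e₁ = true → s.val + 2 ≠ u.val) ∧ (e₂ = true → s.val + 1 ≠ u.val + 1)).card +
      ((univ : Finset (Fin 6)).filter fun t => (e₁ = true ∧ t.val + 1 = u.val) ∨ (e₂ = true ∧ t.val = u.val)).card ≤ 5 := by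
  revert u e₁ e₂; decide

/-! ### §3 Path weights on the star zone -/

/-- Positions on a path are determined by their vertices. -/
theorem pos_eq (π : Equiv.Perm (Fin 7)) {w c : Fin 7} (h : (π w).val = (π c).val) : w.val = c.val :=
  congrArg Fin.val (π.injective (Fin.ext h))

/-- Consecutive positions carry distinct vertices. -/
theorem succ_ne (π : Equiv.Perm (Fin 7)) (t : Fin 6) : (π ⟨t.val, by omega⟩).val ≠ (π ⟨t.val + 1, by omega⟩).val := by
  intro h
  have := pos_eq π h
  dsimp only at this
  omega

section Paths

variable (hs : Sorted7 b) (hz : b 0 - 2 * b 6 < p) (π : Equiv.Perm (Fin 7))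
include hs hz

/-- A heavy path edge `t` sits at the position `u` of vertex `7`: `t = u` or `t + 1 = u`. -/
theorem heavy_edge_at {u : Fin 7} (hu : π u = 6) (t : Fin 6)
    (ht : (p : ℤ) ≤ b 0 - b ((π ⟨t.val, by omega⟩).val + 1) - b ((π ⟨t.val + 1, by omega⟩).val + 1)) :
    t.val = u.val ∨ t.val + 1 = u.val := by
  have hu6 : (π u).val = 6 := by rw [hu]; rfl
  rcases star_edge hs hz (π ⟨t.val, by omega⟩).isLt (π ⟨t.val + 1, by omega⟩).isLt ht with h6 | h6
  · exact Or.inl (pos_eq π (h6.trans hu6.symm))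
  · exact Or.inr (pos_eq π (h6.trans hu6.symm))

/-- The heavy edges of a path number at most `2`. -/
theorem card_edges_le_two :
    ((univ : Finset (Fin 6)).filter fun t =>
      (p : ℤ) ≤ b 0 - b ((π ⟨t.val, by omega⟩).val + 1) - b ((π ⟨t.val + 1, by omega⟩).val + 1)).card ≤ 2 := by
  obtain ⟨u, hu⟩ : ∃ u : Fin 7, π u = 6 := ⟨π.symm 6, π.apply_symm_apply 6⟩
  refine le_trans (card_le_card fun t ht => ?_) (countA' u)
  simp only [mem_filter, mem_univ, true_and] at ht ⊢
  exact heavy_edge_at hs hz π hu t ht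

/-- **`W ≤ 6` when `b₇ < p`.** -/
theorem pathWeight_le_six_of_light (h7 : b 7 < p) : pathWeight b p π ≤ 6 := by
  obtain ⟨u, hu⟩ : ∃ u : Fin 7, π u = 6 := ⟨π.symm 6, π.apply_symm_apply 6⟩
  unfold pathWeight
  refine le_trans (add_le_add (card_le_card fun s hs' => ?_) (card_le_card fun t ht => ?_)) (countA u)
  · simp only [mem_filter, mem_univ, true_and] at hs' ⊢
    intro hsu
    have e : (⟨s.val + 1, by omega⟩ : Fin 7) = u := Fin.ext hsu
    have h6 : (π ⟨s.val + 1, by omega⟩).val = 6 := by rw [e, hu]; rfl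
    have eb : b ((π ⟨s.val + 1, by omega⟩).val + 1) = b 7 := by rw [h6]
    linarith
  · simp only [mem_filter, mem_univ, true_and] at ht ⊢
    exact heavy_edge_at hs hz π hu t ht

/-- **`W ≤ 6` when the star edge `(5,7)` is short** (`b₀ − b₅ − b₇ < p`): the only possible heavy edge is `{6,7}`. -/
theorem pathWeight_le_six_of_short57 (h57 : b 0 - b 5 - b 7 < p) : pathWeight b p π ≤ 6 := by
  obtain ⟨u, hu⟩ : ∃ u : Fin 7, π u = 6 := ⟨π.symm 6, π.apply_symm_apply 6⟩
  obtain ⟨v, hv⟩ : ∃ v : Fin 7, π v = 5 := ⟨π.symm 5, π.apply_symm_apply 5⟩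
  have hu6 : (π u).val = 6 := by rw [hu]; rfl
  have hv5 : (π v).val = 5 := by rw [hv]; rfl
  unfold pathWeight
  have hV : ((univ : Finset (Fin 5)).filter fun t => (p : ℤ) ≤ b ((π ⟨t.val + 1, by omega⟩).val + 1)).card ≤ 5 :=
    le_trans (card_filter_le _ _) (by simp)
  have hE : ((univ : Finset (Fin 6)).filter fun t =>
      (p : ℤ) ≤ b 0 - b ((π ⟨t.val, by omega⟩).val + 1) - b ((π ⟨t.val + 1, by omega⟩).val + 1)).card ≤ 1 := by
    refine le_trans (card_le_card fun t ht => ?_) (countB u v)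
    simp only [mem_filter, mem_univ, true_and] at ht ⊢
    have e67 : b (6 + 1) = b 7 := rfl
    rcases star_edge hs hz (π ⟨t.val, by omega⟩).isLt (π ⟨t.val + 1, by omega⟩).isLt ht with h6 | h6
    · have h5 : (π ⟨t.val + 1, by omega⟩).val = 5 := by
        refine star_partner_five hs h57 (π ⟨t.val + 1, by omega⟩).isLt (by have := succ_ne π t; omega) ?_
        rw [h6, e67] at ht; linarith
      exact Or.inl ⟨pos_eq π (h6.trans hu6.symm), pos_eq π (h5.trans hv5.symm)⟩
    · have h5 : (π ⟨t.val, by omega⟩).val = 5 := by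
        refine star_partner_five hs h57 (π ⟨t.val, by omega⟩).isLt (by have := succ_ne π t; omega) ?_
        rw [h6, e67] at ht; linarith
      exact Or.inr ⟨pos_eq π (h5.trans hv5.symm), pos_eq π (h6.trans hu6.symm)⟩
  omega

/-- **No heavy star partner ⇒ `W ≤ 5`** (with `b₇ < p`): the far end of a heavy edge is light, so the heavy interior slots avoid the
position of vertex `7` and those far ends. -/
theorem pathWeight_le_five_of_noHeavyStar (h7 : b 7 < p)
    (hns : ∀ k : ℕ, k < 6 → (p : ℤ) ≤ b 0 - b (k + 1) - b 7 → b (k + 1) < p) : pathWeight b p π ≤ 5 := by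
  obtain ⟨u, hu⟩ : ∃ u : Fin 7, π u = 6 := ⟨π.symm 6, π.apply_symm_apply 6⟩
  have hu6 : (π u).val = 6 := by rw [hu]; rfl
  unfold pathWeight
  set HV := (univ : Finset (Fin 5)).filter fun t => (p : ℤ) ≤ b ((π ⟨t.val + 1, by omega⟩).val + 1) with hHV
  set HE := (univ : Finset (Fin 6)).filter fun t =>
      (p : ℤ) ≤ b 0 - b ((π ⟨t.val, by omega⟩).val + 1) - b ((π ⟨t.val + 1, by omega⟩).val + 1) with hHE
  -- the far end of a heavy edge is light
  have light_end : ∀ t ∈ HE, (t.val + 1 = u.val → b ((π ⟨t.val, by omega⟩).val + 1) < p) ∧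
      (t.val = u.val → b ((π ⟨t.val + 1, by omega⟩).val + 1) < p) := by
    intro t ht
    rw [hHE, mem_filter] at ht
    obtain ⟨-, ht⟩ := ht
    have hne := succ_ne π t
    constructor
    · intro htu
      have h6 : (π ⟨t.val + 1, by omega⟩).val = 6 := by
        have e : (⟨t.val + 1, by omega⟩ : Fin 7) = u := Fin.ext htu
        rw [e, hu]; rfl
      have eb : b ((π ⟨t.val + 1, by omega⟩).val + 1) = b 7 := by rw [h6]
      exact hns _ (by omega) (by linarith)
    · intro htu
      have h6 : (π ⟨t.val, by omega⟩).val = 6 := by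
        have e : (⟨t.val, by omega⟩ : Fin 7) = u := Fin.ext htu
        rw [e, hu]; rfl
      have eb : b ((π ⟨t.val, by omega⟩).val + 1) = b 7 := by rw [h6]
      exact hns _ (by omega) (by linarith)
  set e₁ : Bool := decide (∃ t ∈ HE, t.val + 1 = u.val) with he₁
  set e₂ : Bool := decide (∃ t ∈ HE, t.val = u.val) with he₂
  refine le_trans (add_le_add (card_le_card fun s hs' => ?_) (card_le_card fun t ht => ?_)) (countC u e₁ e₂)
  · have hs'' := hs'
    rw [hHV, mem_filter] at hs''
    obtain ⟨-, hsv⟩ := hs''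
    simp only [mem_filter, mem_univ, true_and]
    refine ⟨fun hsu => ?_, fun h1 hsu => ?_, fun h2 hsu => ?_⟩
    · have h6 : (π ⟨s.val + 1, by omega⟩).val = 6 := by
        have e : (⟨s.val + 1, by omega⟩ : Fin 7) = u := Fin.ext hsu
        rw [e, hu]; rfl
      have eb : b ((π ⟨s.val + 1, by omega⟩).val + 1) = b 7 := by rw [h6]
      linarith
    · obtain ⟨t, ht, htu⟩ := of_decide_eq_true (he₁ ▸ h1)
      have hl := (light_end t ht).1 htu
      have e : (⟨t.val, by omega⟩ : Fin 7) = ⟨s.val + 1, by omega⟩ := Fin.ext (show t.val = s.val + 1 by omega)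
      rw [e] at hl
      linarith
    · obtain ⟨t, ht, htu⟩ := of_decide_eq_true (he₂ ▸ h2)
      have hl := (light_end t ht).2 htu
      have e : (⟨t.val + 1, by omega⟩ : Fin 7) = ⟨s.val + 1, by omega⟩ := Fin.ext (show t.val + 1 = s.val + 1 by omega)
      rw [e] at hl
      linarith
  · have ht' := ht
    rw [hHE, mem_filter] at ht'
    simp only [mem_filter, mem_univ, true_and]
    rcases heavy_edge_at hs hz π hu t ht'.2 with h | h
    · exact Or.inr ⟨by rw [he₂]; exact decide_eq_true ⟨t, ht, h⟩, h⟩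
    · exact Or.inl ⟨by rw [he₁]; exact decide_eq_true ⟨t, ht, h⟩, h⟩

/-- **`W ≥ 3` ⇒ `b₁ ≥ p`** (some interior vertex is heavy). -/
theorem heavy_of_three (h3 : 3 ≤ pathWeight b p π) : (p : ℤ) ≤ b 1 := by
  have hE := card_edges_le_two hs hz π
  unfold pathWeight at h3
  have hV : 0 < ((univ : Finset (Fin 5)).filter fun t => (p : ℤ) ≤ b ((π ⟨t.val + 1, by omega⟩).val + 1)).card := by omega
  obtain ⟨s, hs'⟩ := card_pos.1 hV
  simp only [mem_filter, mem_univ, true_and] at hs'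
  exact hs'.trans (le_one hs _ (π ⟨s.val + 1, by omega⟩).isLt)

/-- **`W ≥ 6` ⇒ a heavy star partner, and `b₂ ≥ p`.** -/
theorem heavyStar_of_six (h6 : 6 ≤ pathWeight b p π) :
    (∃ k : ℕ, k < 6 ∧ (p : ℤ) ≤ b (k + 1) ∧ (p : ℤ) ≤ b 0 - b (k + 1) - b 7) ∧ (p : ℤ) ≤ b 2 := by
  obtain ⟨s2, s3, s4, s5, s6, s7⟩ := sorted7_chain hs
  have hE := card_edges_le_two hs hz π
  have h6' := h6
  unfold pathWeight at h6'
  by_cases h7 : (p : ℤ) ≤ b 7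
  · -- all parameters are heavy; a heavy edge exists
    refine ⟨?_, by linarith⟩
    have hV : ((univ : Finset (Fin 5)).filter fun t => (p : ℤ) ≤ b ((π ⟨t.val + 1, by omega⟩).val + 1)).card ≤ 5 :=
      le_trans (card_filter_le _ _) (by simp)
    have hEpos : 0 < ((univ : Finset (Fin 6)).filter fun t =>
        (p : ℤ) ≤ b 0 - b ((π ⟨t.val, by omega⟩).val + 1) - b ((π ⟨t.val + 1, by omega⟩).val + 1)).card := by omega
    obtain ⟨t, ht⟩ := card_pos.1 hEpos
    simp only [mem_filter, mem_univ, true_and] at ht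
    have hne := succ_ne π t
    have e67 : b (6 + 1) = b 7 := rfl
    rcases star_edge hs hz (π ⟨t.val, by omega⟩).isLt (π ⟨t.val + 1, by omega⟩).isLt ht with h | h
    · have hlt : (π ⟨t.val + 1, by omega⟩).val < 6 := by have := (π ⟨t.val + 1, by omega⟩).isLt; omega
      refine ⟨(π ⟨t.val + 1, by omega⟩).val, hlt, h7.trans (s7.trans (ge_six hs _ hlt)), ?_⟩
      rw [h, e67] at ht; linarith
    · have hlt : (π ⟨t.val, by omega⟩).val < 6 := by have := (π ⟨t.val, by omega⟩).isLt; omega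
      refine ⟨(π ⟨t.val, by omega⟩).val, hlt, h7.trans (s7.trans (ge_six hs _ hlt)), ?_⟩
      rw [h, e67] at ht; linarith
  · push Not at h7
    refine ⟨?_, ?_⟩
    · by_contra hns
      push Not at hns
      have := pathWeight_le_five_of_noHeavyStar hs hz π h7 fun k hk hks => ?_
      · omega
      · by_contra hkp
        push Not at hkp
        have := hns k hk hkp
        linarith
    · -- two distinct heavy interior vertices; one of them has index ≥ 1
      have hV : 1 < ((univ : Finset (Fin 5)).filter fun t => (p : ℤ) ≤ b ((π ⟨t.val + 1, by omega⟩).val + 1)).card := by omega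
      obtain ⟨s₁, hs₁, s₂, hs₂, hne⟩ := one_lt_card.1 hV
      simp only [mem_filter, mem_univ, true_and] at hs₁ hs₂
      have hne' : (π ⟨s₁.val + 1, by omega⟩).val ≠ (π ⟨s₂.val + 1, by omega⟩).val := by
        intro h
        have := pos_eq π h
        dsimp only at this
        exact hne (Fin.ext (by omega))
      rcases Nat.eq_zero_or_pos (π ⟨s₁.val + 1, by omega⟩).val with h0 | hpos
      · have hpos : 1 ≤ (π ⟨s₂.val + 1, by omega⟩).val := by omega
        exact hs₂.trans (le_two hs _ hpos (π ⟨s₂.val + 1, by omega⟩).isLt)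
      · exact hs₁.trans (le_two hs _ hpos (π ⟨s₁.val + 1, by omega⟩).isLt)

end Paths

/-! ### §4 `C⋆` on the star zone -/

/-- **`C⋆ ≤ 6`** off the sliver {`b₇ ≥ p`, `b₀ − b₅ − b₇ ≥ p`}. -/
theorem cStar_le_six (hs : Sorted7 b) (hz : b 0 - 2 * b 6 < p) (hex : ¬ ((p : ℤ) ≤ b 7 ∧ (p : ℤ) ≤ b 0 - b 5 - b 7)) :
    cStar b p ≤ 6 := by
  refine Finset.sup_le fun π _ => ?_
  by_cases h7 : (p : ℤ) ≤ b 7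
  · exact pathWeight_le_six_of_short57 hs hz π (by push Not at hex; linarith [hex h7])
  · exact pathWeight_le_six_of_light hs hz π (by push Not at h7; exact h7)

/-- `C⋆` is attained by some path. -/
theorem exists_path_eq_cStar (b : ℕ → ℤ) (p : ℕ) : ∃ π : Equiv.Perm (Fin 7), cStar b p = pathWeight b p π := by
  obtain ⟨π, -, hπ⟩ := Finset.exists_mem_eq_sup (univ : Finset (Equiv.Perm (Fin 7))) univ_nonempty (pathWeight b p)
  exact ⟨π, hπ⟩

/-- **`C⋆ ≥ 6` ⇒ the `[LP]` witness (a heavy long star partner) and `b₂ ≥ p`.** -/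
theorem witness_of_cStar_six (hs : Sorted7 b) (hz : b 0 - 2 * b 6 < p) (h6 : 6 ≤ cStar b p) :
    (∃ k : ℕ, k < 6 ∧ (p : ℤ) ≤ b (k + 1) ∧ (p : ℤ) ≤ b 0 - b (k + 1) - b 7) ∧ (p : ℤ) ≤ b 2 := by
  obtain ⟨π, hπ⟩ := exists_path_eq_cStar b p
  exact heavyStar_of_six hs hz π (by rw [← hπ]; exact h6)

/-- **`C⋆ ≥ 3` ⇒ `b₁ ≥ p`.** -/
theorem heavy_of_cStar_three (hs : Sorted7 b) (hz : b 0 - 2 * b 6 < p) (h3 : 3 ≤ cStar b p) : (p : ℤ) ≤ b 1 := by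
  obtain ⟨π, hπ⟩ := exists_path_eq_cStar b p
  exact heavy_of_three hs hz π (by rw [← hπ]; exact h3)

end Summit.KontsevichZagierPeriods.Zeta5Search.DenomLaw.StarZone
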